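import Mathlib
import Summits.NavierStokesRegularity.NavierStokesRegularity.Theorems.SubOnsagerCeilingSideBranchDynamics
import HarnessLib

/-!
# Route SubOnsagerCeiling — the CHAIN DRIVE of the side-branch table `α_SB`
# (helper file for item stmt-NavierStokesRegularity-25507 `OrthantTailCeiling`; `--supports`; def-free)

First brick of the ENGINE for the Onsager-critical escape construction
(`SideBranchCriticalEscapeEstimateAt`, negative lemmas p823602 / p823762 / p823761: the crux
`OrthantTailCeiling` and its restatement `ForwardTailCeiling` are false as soon as, at infinitely many
depths `K`, the block `0..K` of `α_SB` loses `c·(1+ε₀)^{-K}·E₀`).  The escape is to be propagated shell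
by shell by a Katz–Pavlović-type induction; its analytic core is the DRIVE of the next chain mode by
the current one against bounded drains:

* `sideBranch_le_of_deriv_nonneg` — monotonicity on a window `[t₀,t₁]` from a non-negative one-sided
  derivative (folklore);
* `sideBranch_drive_lower_bound` — ODE comparison: `y' ≥ a − r·y` on `[t₀,t₁]`, `y(t₀) ≥ 0`, `r > 0`
  `⇒ y(t) ≥ (a/r)(1 − e^{−r(t−t₀)})` (comparison function `(y − a/r)e^{r(t−t₀)}`);
* `sideBranch_drive_gain` — accumulation: `G' ≥ L·y` with `y ≥ m(1 − e^{−r(t−t₀)})`, `L, m ≥ 0`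
  `⇒ G(t₁) − G(t₀) ≥ L·m·((t₁ − t₀) − 1/r)` (comparison function, no integrals);
* `sideBranch_chain_drive` — the `α_SB` instance: along a regular `ν`-viscous solution on `[0,s]`, if on
  `[t₀,t₁] ⊆ [0,s]` the chain mode at shell `k` keeps `Λ_k x_k² ≥ a` while the receivers are small,
  `0 ≤ x_{k+1}`, `x_{k+2} ≤ ρ`, `s_{k+1} ≤ ρ`, then
  `x_{k+1}(t) ≥ (a/r)(1 − e^{−r(t−t₀)})`, `r = (6/5)Λ_{k+1}ρ + ν_{k+1}`
  (equation `ẋ_{k+1} = Λ_k x_k² − Λ_{k+1}x_{k+1}(x_{k+2} + s_{k+1}/5) − ν_{k+1}x_{k+1}`,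
  `sideBranch_quadTerm_zero`).

HONEST FRAMING: elementary real analysis of a Tao-type MODEL lattice ODE (route SubOnsagerCeiling, rung
TL-M2Break); bricks toward a construction that is NOT carried out here; nothing bears on Navier–Stokes
regularity; no crux is settled here. [cite: Tao2016AveragedNS, §4 (4.2)–(4.3)];
Katz–Pavlović couplings: [cite: BarbatoMorandinRomito2011, §2].
-/

noncomputable section

-- the sub-problem namespace `NavierStokesRegularity.NavierStokesRegularity` is the tree's layout (D-0017)
set_option linter.dupNamespace false

namespace Summit.NavierStokesRegularity.NavierStokesRegularity.Theorems.SubOnsagerCeiling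

open Set
open Literature.Analysis.FluidPDE.TaoCascade

/-! ## Three pieces of calculus on a window `[t₀, t₁]` -/

/-- Monotonicity from a non-negative one-sided derivative on `[t₀,t₁]`: `Φ t₀ ≤ Φ t`. [folklore] -/
theorem sideBranch_le_of_deriv_nonneg {Φ Φ' : ℝ → ℝ} {t₀ t₁ : ℝ}
    (hder : ∀ u ∈ Icc t₀ t₁, HasDerivWithinAt Φ (Φ' u) (Icc t₀ t₁) u)
    (hle : ∀ u ∈ Icc t₀ t₁, 0 ≤ Φ' u) {t : ℝ} (ht : t ∈ Icc t₀ t₁) : Φ t₀ ≤ Φ t := by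
  have hcont : ContinuousOn Φ (Icc t₀ t₁) := fun u hu => (hder u hu).continuousWithinAt
  have hdiff : DifferentiableOn ℝ Φ (interior (Icc t₀ t₁)) := fun u hu => by
    rw [interior_Icc] at hu
    exact ((hder u ⟨hu.1.le, hu.2.le⟩).hasDerivAt
      (Icc_mem_nhds hu.1 hu.2)).differentiableAt.differentiableWithinAt
  have hle' : ∀ u ∈ interior (Icc t₀ t₁), 0 ≤ deriv Φ u := fun u hu => by
    rw [interior_Icc] at hu
    rw [((hder u ⟨hu.1.le, hu.2.le⟩).hasDerivAt (Icc_mem_nhds hu.1 hu.2)).deriv]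
    exact hle u ⟨hu.1.le, hu.2.le⟩
  exact (monotoneOn_of_deriv_nonneg (convex_Icc t₀ t₁) hcont hdiff hle')
    (left_mem_Icc.2 (ht.1.trans ht.2)) ht ht.1

/-- **ODE comparison (the drive).** If `y' = f ≥ a − r·y` within `[t₀,t₁]`, `r > 0` and
`y(t₀) ≥ 0`, then `y(t) ≥ (a/r)(1 − e^{−r(t−t₀)})` on `[t₀,t₁]`. [folklore] -/
theorem sideBranch_drive_lower_bound {y f : ℝ → ℝ} {t₀ t₁ a r : ℝ} (hr : 0 < r)
    (hy : ∀ u ∈ Icc t₀ t₁, HasDerivWithinAt y (f u) (Icc t₀ t₁) u)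
    (hf : ∀ u ∈ Icc t₀ t₁, a - r * y u ≤ f u) (hy0 : 0 ≤ y t₀) {t : ℝ} (ht : t ∈ Icc t₀ t₁) :
    a / r * (1 - Real.exp (-(r * (t - t₀)))) ≤ y t := by
  set Φ : ℝ → ℝ := fun u => (y u - a / r) * Real.exp (r * (u - t₀)) with hΦ
  have hderΦ : ∀ u ∈ Icc t₀ t₁, HasDerivWithinAt Φ
      ((f u - a + r * y u) * Real.exp (r * (u - t₀))) (Icc t₀ t₁) u := by
    intro u hu
    have h1 : HasDerivWithinAt (fun u => y u - a / r) (f u) (Icc t₀ t₁) u := (hy u hu).sub_const _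
    have h2 : HasDerivWithinAt (fun x => Real.exp (r * (x - t₀)))
        (Real.exp (r * (u - t₀)) * (r * 1)) (Icc t₀ t₁) u :=
      (((hasDerivAt_id' u).sub_const t₀).const_mul r).exp.hasDerivWithinAt
    refine (h1.mul h2).congr_deriv ?_
    field_simp
    ring
  have hpos : ∀ u ∈ Icc t₀ t₁, 0 ≤ (f u - a + r * y u) * Real.exp (r * (u - t₀)) := fun u hu =>
    mul_nonneg (by linarith [hf u hu]) (Real.exp_pos _).le
  have hmono := sideBranch_le_of_deriv_nonneg hderΦ hpos ht
  simp only [hΦ, sub_self, mul_zero, Real.exp_zero, mul_one] at hmono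
  have hE : 0 < Real.exp (r * (t - t₀)) := Real.exp_pos _
  have h1 : -(a / r) ≤ (y t - a / r) * Real.exp (r * (t - t₀)) := by linarith
  have h2 : -(a / r) * Real.exp (-(r * (t - t₀))) ≤ y t - a / r := by
    rw [Real.exp_neg, ← div_eq_mul_inv, div_le_iff₀ hE]
    exact h1
  have h3 : a / r * (1 - Real.exp (-(r * (t - t₀)))) =
      a / r + -(a / r) * Real.exp (-(r * (t - t₀))) := by ring
  rw [h3]
  linarith

/-- **Accumulation.** If `G' ≥ L·y` within `[t₀,t₁]` with `y ≥ m(1 − e^{−r(t−t₀)})`, `L, m ≥ 0`,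
`r > 0`, then `G(t₁) − G(t₀) ≥ L·m·((t₁ − t₀) − 1/r)`. [folklore] -/
theorem sideBranch_drive_gain {G G' y : ℝ → ℝ} {t₀ t₁ L m r : ℝ} (hr : 0 < r) (hL : 0 ≤ L)
    (hm : 0 ≤ m) (hG : ∀ u ∈ Icc t₀ t₁, HasDerivWithinAt G (G' u) (Icc t₀ t₁) u)
    (hG' : ∀ u ∈ Icc t₀ t₁, L * y u ≤ G' u)
    (hy : ∀ u ∈ Icc t₀ t₁, m * (1 - Real.exp (-(r * (u - t₀)))) ≤ y u) (ht : t₀ ≤ t₁) :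
    L * m * ((t₁ - t₀) - 1 / r) ≤ G t₁ - G t₀ := by
  set Ψ : ℝ → ℝ := fun u => G u - L * m * ((u - t₀) + Real.exp (-(r * (u - t₀))) / r) with hΨ
  have hderΨ : ∀ u ∈ Icc t₀ t₁, HasDerivWithinAt Ψ
      (G' u - L * m * (1 - Real.exp (-(r * (u - t₀))))) (Icc t₀ t₁) u := by
    intro u hu
    have h1 : HasDerivWithinAt (fun x => Real.exp (-(r * (x - t₀))))
        (Real.exp (-(r * (u - t₀))) * (-(r * 1))) (Icc t₀ t₁) u :=
      (((hasDerivAt_id' u).sub_const t₀).const_mul r).neg.exp.hasDerivWithinAt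
    have h2 : HasDerivWithinAt (fun x => (x - t₀) + Real.exp (-(r * (x - t₀))) / r)
        (1 + Real.exp (-(r * (u - t₀))) * (-(r * 1)) / r) (Icc t₀ t₁) u :=
      ((hasDerivWithinAt_id u _).sub_const t₀).add (h1.div_const r)
    refine ((hG u hu).sub (h2.const_mul (L * m))).congr_deriv ?_
    field_simp
    ring
  have hpos : ∀ u ∈ Icc t₀ t₁, 0 ≤ G' u - L * m * (1 - Real.exp (-(r * (u - t₀)))) := by
    intro u hu
    have h1 := hG' u hu
    have h2 := mul_le_mul_of_nonneg_left (hy u hu) hL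
    nlinarith
  have hmono := sideBranch_le_of_deriv_nonneg hderΨ hpos (right_mem_Icc.2 ht)
  simp only [hΨ, sub_self, mul_zero, neg_zero, Real.exp_zero, zero_add] at hmono
  have hE : 0 < Real.exp (-(r * (t₁ - t₀))) := Real.exp_pos _
  have hLm : 0 ≤ L * m := mul_nonneg hL hm
  have h3 : 0 ≤ L * m * (Real.exp (-(r * (t₁ - t₀))) / r) := mul_nonneg hLm (div_nonneg hE.le hr.le)
  have h4 : L * m * ((t₁ - t₀) - 1 / r) =
      L * m * ((t₁ - t₀) + Real.exp (-(r * (t₁ - t₀))) / r) - L * m * (1 / r) -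
        L * m * (Real.exp (-(r * (t₁ - t₀))) / r) := by ring
  rw [h4]
  linarith

/-! ## The chain drive of `α_SB` -/

section Solution

variable {ε₀ ν s : ℝ} {X : Fin 4 → ℤ → ℝ → ℝ}

/-- **The chain drive of `α_SB`.** Along a regular solution of the `ν`-viscous `α_SB` lattice on `[0,s]`
(`ν > 0`), let `[t₀,t₁] ⊆ [0,s]` and suppose on `[t₀,t₁]`: `Λ_k x_k² ≥ a` (the driver is on),
`x_{k+1} ≥ 0`, and the receivers/drains of `x_{k+1}` are small, `x_{k+2} ≤ ρ`, `s_{k+1} ≤ ρ` (`ρ ≥ 0`).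
Then `x_{k+1}(t) ≥ (a/r)(1 − e^{−r(t−t₀)})` on `[t₀,t₁]` with `r = (6/5)Λ_{k+1}ρ + ν_{k+1}`
(`Λ_n = (1+ε₀)^{5n/2}`, `ν_n = ν(1+ε₀)^{2n}`). [this file] -/
theorem sideBranch_chain_drive (hε : 0 < ε₀) (hν : 0 < ν)
    (hder : ∀ (i : Fin 4) (k : ℤ), ∀ t ∈ Icc (0 : ℝ) s, HasDerivWithinAt (X i k)
      (quadTerm ε₀ sideBranchTable X i k t - ν * (1 + ε₀) ^ ((2 : ℝ) * k) * X i k t)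
      (Icc (0 : ℝ) s) t)
    (k : ℤ) {t₀ t₁ a ρ : ℝ} (ht₀ : 0 ≤ t₀) (ht₁ : t₁ ≤ s) (hρ : 0 ≤ ρ)
    (hx : ∀ u ∈ Icc t₀ t₁, a ≤ (1 + ε₀) ^ ((5 : ℝ) * k / 2) * X 0 k u ^ 2)
    (hy0 : ∀ u ∈ Icc t₀ t₁, 0 ≤ X 0 (k + 1) u)
    (hx2 : ∀ u ∈ Icc t₀ t₁, X 0 (k + 1 + 1) u ≤ ρ)
    (hs1 : ∀ u ∈ Icc t₀ t₁, X 1 (k + 1) u ≤ ρ) {t : ℝ} (ht : t ∈ Icc t₀ t₁) :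
    a / ((6 / 5 : ℝ) * (1 + ε₀) ^ ((5 : ℝ) * ((k + 1 : ℤ) : ℝ) / 2) * ρ +
          ν * (1 + ε₀) ^ ((2 : ℝ) * ((k + 1 : ℤ) : ℝ))) *
        (1 - Real.exp (-(((6 / 5 : ℝ) * (1 + ε₀) ^ ((5 : ℝ) * ((k + 1 : ℤ) : ℝ) / 2) * ρ +
          ν * (1 + ε₀) ^ ((2 : ℝ) * ((k + 1 : ℤ) : ℝ))) * (t - t₀)))) ≤ X 0 (k + 1) t := by
  have hb : (0 : ℝ) < 1 + ε₀ := by linarith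
  set Λ₁ : ℝ := (1 + ε₀) ^ ((5 : ℝ) * ((k + 1 : ℤ) : ℝ) / 2) with hΛ₁
  set c₁ : ℝ := ν * (1 + ε₀) ^ ((2 : ℝ) * ((k + 1 : ℤ) : ℝ)) with hc₁
  have hΛ₁0 : 0 < Λ₁ := Real.rpow_pos_of_pos hb _
  have hc₁0 : 0 < c₁ := mul_pos hν (Real.rpow_pos_of_pos hb _)
  set r : ℝ := (6 / 5 : ℝ) * Λ₁ * ρ + c₁ with hrdef
  have hr : 0 < r := by positivity
  have hsub : Icc t₀ t₁ ⊆ Icc (0 : ℝ) s := Icc_subset_Icc ht₀ ht₁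
  -- the equation of `x_{k+1}` within the window
  have hy : ∀ u ∈ Icc t₀ t₁, HasDerivWithinAt (X 0 (k + 1))
      (quadTerm ε₀ sideBranchTable X 0 (k + 1) u - c₁ * X 0 (k + 1) u) (Icc t₀ t₁) u :=
    fun u hu => (hder 0 (k + 1) u (hsub hu)).mono hsub
  have hfeed : (1 + ε₀) ^ ((5 : ℝ) * (((k + 1 : ℤ) : ℝ) - 1) / 2) = (1 + ε₀) ^ ((5 : ℝ) * k / 2) := by
    push_cast; ring_nf
  have hf : ∀ u ∈ Icc t₀ t₁, a - r * X 0 (k + 1) u ≤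
      quadTerm ε₀ sideBranchTable X 0 (k + 1) u - c₁ * X 0 (k + 1) u := by
    intro u hu
    rw [sideBranch_quadTerm_zero, hfeed, ← hΛ₁, add_sub_cancel_right]
    have hyu := hy0 u hu
    have h1 : X 0 (k + 1) u * X 0 (k + 1 + 1) u ≤ X 0 (k + 1) u * ρ :=
      mul_le_mul_of_nonneg_left (hx2 u hu) hyu
    have h2 : X 0 (k + 1) u * X 1 (k + 1) u ≤ X 0 (k + 1) u * ρ :=
      mul_le_mul_of_nonneg_left (hs1 u hu) hyu
    have h3 := hx u hu
    have h4 : Λ₁ * (X 0 (k + 1) u * X 0 (k + 1 + 1) u) ≤ Λ₁ * (X 0 (k + 1) u * ρ) :=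
      mul_le_mul_of_nonneg_left h1 hΛ₁0.le
    have h5 : (1 / 5 : ℝ) * Λ₁ * (X 0 (k + 1) u * X 1 (k + 1) u) ≤
        (1 / 5 : ℝ) * Λ₁ * (X 0 (k + 1) u * ρ) := mul_le_mul_of_nonneg_left h2 (by positivity)
    have h6 : r * X 0 (k + 1) u = Λ₁ * (X 0 (k + 1) u * ρ) + (1 / 5 : ℝ) * Λ₁ * (X 0 (k + 1) u * ρ) +
        c₁ * X 0 (k + 1) u := by rw [hrdef]; ring
    linarith
  have hy00 : 0 ≤ X 0 (k + 1) t₀ := hy0 t₀ (left_mem_Icc.2 (ht.1.trans ht.2))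
  exact sideBranch_drive_lower_bound hr hy hf hy00 ht

end Solution

end Summit.NavierStokesRegularity.NavierStokesRegularity.Theorems.SubOnsagerCeiling

end
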